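import Summits.AtomisticToContinuum.HydrodynamicLimit.Theorems.CollisionIsometryCLTCollisionalTransferLocalityDefsC
import Summits.AtomisticToContinuum.HydrodynamicLimit.Theorems.CollisionIsometryCLTCollisionalTransferLocalityPressureEquation
import Literature.Analysis.FluidPDE.HardSphereAlexander
import HarnessLib

/-!
# Audit lemmas for stub [B-dyn]° `stub_contactVirialE` (line hemisphere-affine-slaving, crux 9518, v8)

Sorry-free bookkeeping facts found during the adversarial audit of the RE-KEYED research stub
`stub_contactVirialE` (`ContactVirial … (pOf Y σ)` from `StaticShell Y η₀`, energy cap `E₀`,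
`VirialBounded`, `DiluteAt … η₁`; stub worker W-B of the lead prover-line-stmt-AtomisticToContinuum-9518-c4-0,
census `work/stubs/stub_contactVirialE.census.md`). The stub itself is NOT proved here (research-level);
these lemmas settle the cheap-kill questions of the audit inside the kernel:

* `staticShell_unique` : two value functions with the static thin-shell property agree on `(0, min η₀ η₀')`
  (the `∀ Φ` of `StaticShell` is non-vacuous for large `N` by the tree's Alexander theorem and its integrand
  does not depend on `Φ`), so the `∀ Y` of the stub is "the true static intensity and any extension of it";
* `pOf_congr_of_le`, `contactVirial_congr_of_diluteAt` : on the dilute event `p_Y(ρ̄, θ̄)` only evaluates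
  `Y` on `(0, η₁]` (`ρ̄ ≥ 0`, `ρ̄ = 0 ⇒ p_Y = 0` whatever `Y 0`), hence `ContactVirial … (pOf Y σ)` is
  invariant under changing `Y` off `(0, η₁]` given `DiluteAt … η₁` (junk values of `Y` never enter);
* `contactVirial_of_energyCap_of_neg` : a NEGATIVE energy cap `E₀ < 0` makes the energy hypothesis say
  `P_N(univ) → 0`, under which every conclusion in local-Gibbs probability holds — the arbitrary real `E₀`
  of the v8 keying is harmless;
* `stub_contactVirialE_of_instance`, `staticShell_ZPi'` : the registered `∀ (Y, η₀)` statement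
  restricted to `η₀ ≤ η₀'` FOLLOWS from its single instance at any `(Y', η₀')` with `StaticShell Y' η₀'`
  — in particular (with the landed [B-stat] `stub_pressureEquation`, i.e. `StaticShell ZPi η₀'`) it is
  equivalent to its instance at the tree's value function `ZPi = 6(Z − 1)` below the contact theorem's
  radius: EOS-freeness costs nothing there.
-/

namespace Summit.AtomisticToContinuum.HydrodynamicLimit.Theorems.HemisphereAffineSlaving

open scoped BigOperators Topology Classical ENNReal
open Filter Set Function MeasureTheory

noncomputable section

open Literature.MathematicalPhysics.KineticTheory (T3 V3)

/-! ## 1. The static value function is pinned on `(0, η₀)` -/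

/-- The diameter `ε_N = σ (N+1)^{-1/3}` is eventually below `1/2` (the range of Alexander's theorem on
the torus). [folklore] -/
theorem eventually_hsDiameter_lt_half (σ : ℝ) :
    ∀ᶠ N : ℕ in atTop, Literature.MathematicalPhysics.KineticTheory.hsDiameter σ N < 2⁻¹ := by
  have h1 : Tendsto (fun N : ℕ => (((N + 1 : ℕ) : ℝ))) atTop atTop :=
    tendsto_natCast_atTop_atTop.comp (tendsto_add_atTop_nat 1)
  have h2 := (tendsto_rpow_neg_atTop (by norm_num : (0 : ℝ) < 1 / 3)).comp h1
  have h3 : Tendsto (fun N : ℕ => Literature.MathematicalPhysics.KineticTheory.hsDiameter σ N)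
      atTop (𝓝 (σ * 0)) := h2.const_mul σ
  rw [mul_zero] at h3
  exact h3.eventually (gt_mem_nhds (by norm_num))

/-- **Uniqueness of the static contact intensity.** Two value functions with the static thin-shell
property agree on `(0, min η₀ η₀')`: for `η` there, `σ := η^{1/3}` is admissible in both, the hard-sphere
flow exists for large `N` (`HardSphereFlow.nonempty_torus_holds`), and the shell functional at one and the
same `(h, N, Φ)` is within `e/2` of both `Y η` and `Y' η`. [folklore] -/
theorem staticShell_unique : ∀ {Y Y' : ℝ → ℝ} {η₀ η₀' : ℝ}, StaticShell Y η₀ → StaticShell Y' η₀' → ∀ {η : ℝ}, 0 < η → η < η₀ → η < η₀' → Y η = Y' η := by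
  intro Y Y' η₀ η₀' hY hY' η hη h1 h2
  set σ : ℝ := η ^ ((1 : ℝ) / 3) with hσ_def
  have hσ : 0 < σ := Real.rpow_pos_of_pos hη _
  have hσ3 : σ ^ 3 = η := by
    rw [hσ_def, ← Real.rpow_natCast, ← Real.rpow_mul hη.le]
    norm_num
  have h1' : σ ^ 3 < η₀ := by rw [hσ3]; exact h1
  have h2' : σ ^ 3 < η₀' := by rw [hσ3]; exact h2
  refine eq_of_forall_dist_le fun e he => ?_
  rw [Real.dist_eq]
  have he2 : 0 < e / 2 := half_pos he
  obtain ⟨h₀, hh₀, H⟩ := hY σ hσ h1' 1 one_pos (e / 2) he2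
  obtain ⟨h₀', hh₀', H'⟩ := hY' σ hσ h2' 1 one_pos (e / 2) he2
  have hmin : 0 < min h₀ h₀' := lt_min hh₀ hh₀'
  obtain ⟨N₀, hN₀⟩ := H (min h₀ h₀' / 2) (half_pos hmin)
    ((half_lt_self hmin).trans_le (min_le_left _ _))
  obtain ⟨N₀', hN₀'⟩ := H' (min h₀ h₀' / 2) (half_pos hmin)
    ((half_lt_self hmin).trans_le (min_le_right _ _))
  obtain ⟨N, hN1, hN2, hN3⟩ := ((eventually_ge_atTop N₀).and ((eventually_ge_atTop N₀').and
    (eventually_hsDiameter_lt_half σ))).exists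
  obtain ⟨Φ⟩ := Literature.Analysis.FluidPDE.HardSphereFlow.nonempty_torus_holds (d := Fin 3)
    (Literature.MathematicalPhysics.KineticTheory.hsDiameter_pos hσ N) hN3 (N + 1)
  have e1 := hN₀ N hN1 Φ
  have e2 := hN₀' N hN2 Φ
  rw [hσ3] at e1 e2
  obtain ⟨e1a, e1b⟩ := abs_le.1 e1
  obtain ⟨e2a, e2b⟩ := abs_le.1 e2
  rw [abs_le]
  constructor <;> linarith

/-! ## 2. On the dilute event `p_Y` only sees `Y` on `(0, η₁]` -/

/-- The block density of a nonnegative kernel is nonnegative. [folklore] -/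
private theorem rhoB_nonneg' {φ : ℕ → T3 → ℝ} {N : ℕ} (hφ : ∀ y, 0 ≤ φ N y) (z : Cfg N) (x : T3) :
    0 ≤ rhoB φ N z x := by
  unfold rhoB Literature.MathematicalPhysics.KineticTheory.empiricalDensityField
  exact integral_nonneg fun y => hφ _

/-- At a density `r ≥ 0` with `r σ³ ≤ η₁` (`σ > 0`), `p_{Y₁}(r, θ) = p_{Y₂}(r, θ)` as soon as `Y₁ = Y₂` on
`(0, η₁]`: at `r = 0` both vanish whatever `Y₁ 0`, `Y₂ 0`. [folklore] -/
theorem pOf_congr_of_le {Y₁ Y₂ : ℝ → ℝ} {η₁ σ : ℝ} (hσ : 0 < σ)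
    (hY : ∀ η, 0 < η → η ≤ η₁ → Y₁ η = Y₂ η) {r : ℝ} (hr : 0 ≤ r) (hle : r * σ ^ 3 ≤ η₁) (th : ℝ) :
    pOf Y₁ σ r th = pOf Y₂ σ r th := by
  rcases hr.eq_or_lt with h0 | hpos
  · subst h0
    simp [pOf]
  · simp only [pOf, hY _ (by positivity) hle]

/-- **`ContactVirial … (pOf Y σ)` is invariant under changing `Y` off `(0, η₁]` on the dilute event.**
For `σ > 0`, a nonnegative kernel family and `DiluteAt … η₁`: if `Y₁ = Y₂` on `(0, η₁]` then
`ContactVirial … (pOf Y₁ σ) → ContactVirial … (pOf Y₂ σ)` (off the dilute-bad event every block density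
`ρ̄(s, x)`, `s ≤ τ ≤ t`, has `ρ̄ σ³ ∈ [0, η₁]`, so `RhsG`, `KfunG` agree pointwise; the bad event costs
`P → 0`). [folklore] -/
theorem contactVirial_congr_of_diluteAt {σ : ℝ} (hσ : 0 < σ) {a₀ θ₀ : T3 → ℝ} {u₀ : T3 → V3}
    {Φ : Flows σ} {φ : ℕ → T3 → ℝ} (hφ : ∀ N y, 0 ≤ φ N y) {t η₁ : ℝ} {Y₁ Y₂ : ℝ → ℝ}
    (hY : ∀ η, 0 < η → η ≤ η₁ → Y₁ η = Y₂ η) (hD : DiluteAt σ a₀ θ₀ u₀ Φ t φ η₁)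
    {ψ : ℝ → T3 → V3} {χ : ℝ → T3 → ℝ} (h : ContactVirial σ a₀ θ₀ u₀ Φ φ t ψ χ (pOf Y₁ σ)) :
    ContactVirial σ a₀ θ₀ u₀ Φ φ t ψ χ (pOf Y₂ σ) := by
  intro δ hδ
  have hsum := (h δ hδ).add hD
  rw [add_zero] at hsum
  refine tendsto_of_tendsto_of_tendsto_of_le_of_le tendsto_const_nhds hsum (fun N => bot_le) fun N => ?_
  refine (measure_mono ?_).trans (measure_union_le _ _)
  rintro z ⟨τ, hτ, hz⟩
  by_cases hbad : ∃ s ∈ Icc 0 t, ∃ x : T3, η₁ < rhoB φ N ((Φ N).flow s z) x * σ ^ 3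
  · exact Or.inr hbad
  · left
    push Not at hbad
    refine ⟨τ, hτ, ?_⟩
    have hR : RhsG σ Φ φ ψ χ (pOf Y₁ σ) N z τ = RhsG σ Φ φ ψ χ (pOf Y₂ σ) N z τ := by
      unfold RhsG
      refine setIntegral_congr_fun measurableSet_Icc fun s hs => ?_
      refine integral_congr_ae (ae_of_all _ fun x => ?_)
      dsimp only
      rw [pOf_congr_of_le hσ hY (rhoB_nonneg' (hφ N) _ x) (hbad s ⟨hs.1, hs.2.trans hτ.2⟩ x)]
    have hK : KfunG σ Φ φ ψ χ (pOf Y₁ σ) N z τ = KfunG σ Φ φ ψ χ (pOf Y₂ σ) N z τ := by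
      unfold KfunG
      refine setIntegral_congr_fun measurableSet_Icc fun s hs => ?_
      refine integral_congr_ae (ae_of_all _ fun x => ?_)
      dsimp only
      rw [pOf_congr_of_le hσ hY (rhoB_nonneg' (hφ N) _ x) (hbad s ⟨hs.1, hs.2.trans hτ.2⟩ x)]
    rw [hR, hK]
    exact hz

/-! ## 3. A negative energy cap degenerates the laws (harmless) -/

/-- **Negative energy cap.** If `E₀ < 0` and `0 ≤ t`, the energy event of the v8 keying is everything
(`(N+1)⁻¹ E(Φ_0 z) ≥ 0 > E₀`), so its hypothesis says `P_N(univ) → 0`, and then `ContactVirial` holds for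
EVERY pressure function. [folklore] -/
theorem contactVirial_of_energyCap_of_neg {σ : ℝ} {a₀ θ₀ : T3 → ℝ} {u₀ : T3 → V3} {Φ : Flows σ}
    {t E₀ : ℝ} (ht : 0 ≤ t) (hE : E₀ < 0)
    (hcap : Tendsto (fun N : ℕ => Literature.MathematicalPhysics.KineticTheory.localGibbsLaw σ a₀ u₀ θ₀ N (Φ N)
      {z | ∃ s ∈ Icc 0 t, E₀ < ((N : ℝ) + 1)⁻¹ *
        Literature.Analysis.FluidPDE.configEnergy ((Φ N).flow s z)}) atTop (𝓝 0))
    (φ : ℕ → T3 → ℝ) (ψ : ℝ → T3 → V3) (χ : ℝ → T3 → ℝ) (p : ℝ → ℝ → ℝ) :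
    ContactVirial σ a₀ θ₀ u₀ Φ φ t ψ χ p := by
  intro δ _hδ
  refine tendsto_of_tendsto_of_tendsto_of_le_of_le tendsto_const_nhds hcap (fun N => bot_le)
    fun N => measure_mono fun z _ => ?_
  refine ⟨0, ⟨le_rfl, ht⟩, hE.trans_le ?_⟩
  refine mul_nonneg (inv_nonneg.2 (by positivity)) ?_
  unfold Literature.Analysis.FluidPDE.configEnergy
  positivity

/-! ## 4. The `∀ (Y, η₀)` of the stub versus one instance -/

/-- **Monotonicity in the value function / EOS-freeness costs nothing below a static radius.** If the body
of the registered stub holds at ONE pair `(Y', η₀')` with `StaticShell Y' η₀'`, then the registered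
`∀ (Y, η₀)` statement holds for every `η₀ ≤ η₀'`: below `η₁ < η₀` the two value functions agree
(`staticShell_unique`) and the conclusion only sees them there (`contactVirial_congr_of_diluteAt`). With
`(Y', η₀') := (ZPi, η₀(B-stat))` (`staticShell_ZPi'`) the stub restricted to the contact theorem's radius is
therefore equivalent to its `ZPi`-instance (the converse direction is instantiation). [folklore] -/
theorem stub_contactVirialE_of_instance (Y' : ℝ → ℝ) (η₀' : ℝ) (hS' : StaticShell Y' η₀')
    (hB : ∀ η₁ : ℝ, 0 < η₁ → η₁ < η₀' → ∀ (a₀ θ₀ : T3 → ℝ) (u₀ : T3 → V3), NiceProfiles a₀ θ₀ u₀ → ∃ σ₀ : ℝ, 0 < σ₀ ∧ ∀ σ : ℝ, 0 < σ → σ < σ₀ → ∀ (Φ : Flows σ) (t E₀ : ℝ), 0 < t → Tendsto (fun N : ℕ => Literature.MathematicalPhysics.KineticTheory.localGibbsLaw σ a₀ u₀ θ₀ N (Φ N) {z | ∃ s ∈ Icc 0 t, E₀ < ((N : ℝ) + 1)⁻¹ * Literature.Analysis.FluidPDE.configEnergy ((Φ N).flow s z)}) atTop (𝓝 0) → VirialBounded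 σ a₀ θ₀ u₀ Φ t → ∀ (γ C : ℝ) (φ : ℕ → T3 → ℝ), 0 < γ → γ ≤ 1 / 15 → AdmissibleKernel γ C φ → DiluteAt σ a₀ θ₀ u₀ Φ t φ η₁ → ∀ (ψ : ℝ → T3 → V3) (χ : ℝ → T3 → ℝ), Literature.Analysis.FunctionSpaces.Torus.IsSmoothSpaceTimeOn (Icc 0 t) ψ → Literature.Analysis.FunctionSpaces.Torus.IsSmoothSpaceTimeOn (Icc 0 t) χ → ContactVirial σ a₀ θ₀ u₀ Φ φ t ψ χ (pOf Y' σ)) :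
    ∀ (Y : ℝ → ℝ) (η₀ : ℝ), 0 < η₀ → η₀ ≤ η₀' → StaticShell Y η₀ → ∀ η₁ : ℝ, 0 < η₁ → η₁ < η₀ → ∀ (a₀ θ₀ : T3 → ℝ) (u₀ : T3 → V3), NiceProfiles a₀ θ₀ u₀ → ∃ σ₀ : ℝ, 0 < σ₀ ∧ ∀ σ : ℝ, 0 < σ → σ < σ₀ → ∀ (Φ : Flows σ) (t E₀ : ℝ), 0 < t → Tendsto (fun N : ℕ => Literature.MathematicalPhysics.KineticTheory.localGibbsLaw σ a₀ u₀ θ₀ N (Φ N) {z | ∃ s ∈ Icc 0 t, E₀ < ((N : ℝ) + 1)⁻¹ * Literature.Analysis.FluidPDE.configEnergy ((Φ N).flow s z)}) atTop (𝓝 0) → VirialBounded σ a₀ θ₀ u₀ Φ t → ∀ (γ C : ℝ) (φ : ℕ → T3 → ℝ), 0 < γ → γ ≤ 1 / 15 → AdmissibleKernel γ C φ → DiluteAt σ a₀ θ₀ u₀ Φ t φ η₁ → ∀ (ψ : ℝ → T3 → V3) (χ : ℝ → T3 → ℝ), Literature.Analysis.FunctionSpaces.Torus.IsSmoothSpaceTimeOn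 (Icc 0 t) ψ → Literature.Analysis.FunctionSpaces.Torus.IsSmoothSpaceTimeOn (Icc 0 t) χ → ContactVirial σ a₀ θ₀ u₀ Φ φ t ψ χ (pOf Y σ) := by
  intro Y η₀ _h0 hle hS η₁ hη₁ hη₁0 a₀ θ₀ u₀ hP
  obtain ⟨σ₀, hσ₀, H⟩ := hB η₁ hη₁ (hη₁0.trans_le hle) a₀ θ₀ u₀ hP
  refine ⟨σ₀, hσ₀, fun σ hσ hσσ₀ Φ t E₀ ht hE hV γ C φ hγ hγ' hK hD ψ χ hψ hχ => ?_⟩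
  exact contactVirial_congr_of_diluteAt hσ hK.2.1
    (fun η h0 h1 => staticShell_unique hS' hS h0 ((h1.trans_lt hη₁0).trans_le hle) (h1.trans_lt hη₁0))
    hD (H σ hσ hσσ₀ Φ t E₀ ht hE hV γ C φ hγ hγ' hK hD ψ χ hψ hχ)

/-- [B-stat] in this vocabulary (the sibling line's landed `stub_pressureEquation`, p100223):
`∃ η₀ > 0, StaticShell ZPi η₀` (same proof as the skeleton's `staticShell_ZPi`). -/
theorem staticShell_ZPi' : ∃ η₀ : ℝ, 0 < η₀ ∧ StaticShell ZPi η₀ := by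
  obtain ⟨η₀, hη₀, H⟩ :=
    Summit.AtomisticToContinuum.HydrodynamicLimit.Theorems.ConditionalCovarianceLiouvilleRigidity.stub_pressureEquation
  refine ⟨η₀, hη₀, fun σ hσ hσ3 θ hθ e he => ?_⟩
  obtain ⟨h₀, hh₀, Hh⟩ := H σ hσ hσ3 θ hθ e he
  refine ⟨h₀, hh₀, fun h hh hhh => ?_⟩
  obtain ⟨N₀, HN⟩ := Hh h hh hhh
  exact ⟨N₀, fun N hN Φ => by simpa only [ZPi] using HN N hN Φ⟩

end

end Summit.AtomisticToContinuum.HydrodynamicLimit.Theorems.HemisphereAffineSlaving
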